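import Literature.AlgebraicGeometry.Motives.HypersurfaceFormsNonsingular
import Literature.AlgebraicGeometry.Resolution.OriginLocalRing
import Mathlib.RingTheory.MvPolynomial.EulerIdentity
import Mathlib.RingTheory.MvPolynomial.Homogeneous
import Summits.HodgeConjecture.HodgeConjecture.Theorems.PadicSemiregularLiftSemiregularSeedsOnAnchorsDefs
import Summits.HodgeConjecture.HodgeConjecture.Theorems.PadicSemiregularLiftSemiregularSeedsOnAnchorsJacobianColonEqLocal
import HarnessLib

/-!
# Stub S1 of line `gorenstein-ci-seeds`: `(J^F : P_Z) = ⟨f, g⟩` (Villaflor, Remark 1)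

LOG (worker of lead `prover-line-stmt-HodgeConjecture-13941-0`, crux stmt-HodgeConjecture-13941):
* landed `…JacobianColonEqHelpers` (p76915, commit 2ab54bd86484; Cramer; transition-determinant
  colon identity under mixed-ideal non-zero-divisor hypotheses; registered sub-goal
  `mem_span_of_det_mul_mem_span`);
* landed `…JacobianColonEqLocal` (p78331, commit 4a2dae9255a6; discharge of those hypotheses for
  systems of parameters of a regular local ring via the tree's `mem_of_mul_mem_of_sop`; descent to
  `R`; registered sub-goal `mem_span_of_det_mul_mem_span_of_isMaximal`);
* this file: the registered stub `stub_jacobianColon_eq`, exactly the statement `JacobianColonEq`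
  of the Defs file; proved (rc 0, 0 sorries, axioms propext/Classical.choice/Quot.sound, checked
  with the Defs §1 inlined: `work/stubs/JacobianColonEq.inlineDefs.lean`). NOTHING IS STUCK; the
  only missing piece is that the Defs module imported below is not yet in the tree — land with
  `ledger propose --kind proof --target Summits/HodgeConjecture/HodgeConjecture/Theorems/
  PadicSemiregularLiftSemiregularSeedsOnAnchorsJacobianColonEq.lean --file work/stubs/JacobianColonEq.lean
  --supports stmt-HodgeConjecture-13941` once `…SeedsOnAnchorsDefs` has landed and is built.

Crux `PadicSemiregularLift.SemiregularSeedsOnAnchors`, line `gorenstein-ci-seeds`, stub S1. For a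
field `k`, a nonsingular form `F ∈ k[x₀, …, x₅]` of degree `m ≥ 3` with `m ≠ 0` in `k`, and a
CI-type datum `Z` (`F = Σ fᵢ gᵢ`, `H = (f, g)`, `P_Z = det (∂ⱼ Hᵢ)`), the colon ideal of the
Jacobian ideal `J^F = (∂₀F, …, ∂₅F)` by the transition determinant is `(J^F : P_Z) = ⟨H⟩`
(R. Villaflor Loyola, *Periods of complete intersection algebraic cycles*, Rem. 1).

Proof. Write `c = (g, f)` (the halves of `H` swapped) and `N = (∂ⱼ Hₗ)ⱼₗ`, so that
`∇F = N c` (Leibniz) and `det N = P_Z`. (⊇) is Cramer: `P_Z · c_l ∈ J^F`. (⊆): every prime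
containing `⟨H⟩` or `J^F` contains `F` and all `∂ⱼF` (Euler: `m F = Σ xⱼ ∂ⱼF`), hence all `xᵢ`
(`IsNonsingularForm`), so both ideals are primary for `𝔪 = (x₀, …, x₅)`; in the regular local ring
`k[x]_𝔪` of dimension `6` the six forms `c` are a system of parameters, and the abstract colon
identity `((N c) : det N) ⊆ (c)` of the helper files
(`mem_span_of_det_mul_mem_span_of_isMaximal`: Cramer twice, independence of the transition
determinant modulo `(cᵢ^{L+1})ᵢ`, and `(∏ cᵢ^L) q ∈ (cᵢ^{L+1}) ⟹ q ∈ (c)`, all resting on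
"the last member of a system of parameters of a regular local ring is a non-zero-divisor modulo
the others") gives the claim in `k[x]` by saturation of the `𝔪`-primary ideal `⟨H⟩`.
-/

noncomputable section

-- the summit namespace `Summit.HodgeConjecture.HodgeConjecture.…` repeats a component by design
set_option linter.dupNamespace false

open MvPolynomial Matrix Literature.AlgebraicGeometry.Motives
open Literature.AlgebraicGeometry.Resolution

universe u

namespace Summit.HodgeConjecture.HodgeConjecture.Theorems.SemiregularSeedsOnAnchors.GorensteinCiSeeds

variable {k : Type u} [Field k]

/-! ## Forms of positive degree and `𝔪`-primarity from nonsingularity -/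

/-- A form of positive degree has no constant term. [folklore] -/
theorem constantCoeff_eq_zero_of_isHomogeneous {σ : Type*} {φ : MvPolynomial σ k} {n : ℕ}
    (hφ : φ.IsHomogeneous n) (hn : 0 < n) : constantCoeff φ = 0 := by
  rw [constantCoeff_eq]
  exact hφ.coeff_eq_zero (by rw [map_zero]; exact hn.ne)

/-- **Nonsingularity as primarity**: for a nonsingular form `F`, every ideal containing `F` and all
`∂ⱼF` contains a power of the irrelevant ideal `𝔪 = (x₀, …, x₅)` (every prime over it contains all
`xᵢ`). [cite: Hartshorne1977, I Ex. 5.8] -/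
theorem exists_originIdeal_pow_le {F : MvPolynomial (Fin 6) k}
    (hF : SmoothHypersurface.IsNonsingularForm k F) {I : Ideal (MvPolynomial (Fin 6) k)}
    (hFI : F ∈ I) (hdI : ∀ j, pderiv j F ∈ I) : ∃ N, originIdeal k 6 ^ N ≤ I := by
  apply Ideal.exists_pow_le_of_le_radical_of_fg _ (IsNoetherian.noetherian _)
  rw [Ideal.radical_eq_sInf, originIdeal_eq_span]
  refine le_sInf ?_
  rintro 𝔭 ⟨hI𝔭, h𝔭⟩
  rw [Ideal.span_le]
  rintro _ ⟨i, rfl⟩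
  exact hF 𝔭 h𝔭 (hI𝔭 hFI) (fun j => hI𝔭 (hdI j)) i

/-- **Euler**: a form `F` of degree `m` with `m ≠ 0` in `k` lies in its Jacobian ideal
(`m F = Σ xⱼ ∂ⱼF`). [folklore] -/
theorem mem_jacobianIdeal_self {F : MvPolynomial (Fin 6) k} {m : ℕ} (hF : F.IsHomogeneous m)
    (hm : (m : k) ≠ 0) : F ∈ jacobianIdeal F := by
  have hmem : m • F ∈ jacobianIdeal F := by
    rw [← hF.sum_X_mul_pderiv]
    exact Submodule.sum_mem _ fun i _ => Ideal.mul_mem_left _ _ (Ideal.subset_span ⟨i, rfl⟩)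
  rw [nsmul_eq_mul, ← map_natCast (C : k →+* MvPolynomial (Fin 6) k) m,
    Ideal.unit_mul_mem_iff_mem _ ((IsUnit.mk0 _ hm).map C)] at hmem
  exact hmem

/-! ## The swapped forms `c = (g, f)` and the transposed Jacobian matrix `N = (∂ⱼ Hₗ)ⱼₗ` -/

/-- Summing over `Fin 6 = Fin 3 ⊕ Fin 3`. [folklore] -/
theorem sum_fin_six_halves {M : Type*} [AddCommMonoid M] (φ : Fin 3 ⊕ Fin 3 → M) :
    ∑ l : Fin 6, φ ((finSumFinEquiv (m := 3) (n := 3)).symm (Fin.cast rfl l)) =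
      ∑ i, φ (Sum.inl i) + ∑ i, φ (Sum.inr i) := by
  rw [← Fintype.sum_sum_type]
  exact Equiv.sum_comp (finSumFinEquiv (m := 3) (n := 3)).symm φ

variable {F : MvPolynomial (Fin 6) k} {m : ℕ}

/-- **Leibniz**: `∂ⱼF = Σₗ ∂ⱼHₗ · cₗ` with `c = (g, f)`, i.e. `∇F = N c` for `N = (∂ⱼHₗ)ⱼₗ`, the
transpose of the matrix whose determinant is `P_Z`. [cite: Villaflor2022PeriodsCI, §1] -/
theorem jacobian_mulVec_swap (Z : CIDatum F m) (j : Fin 6) :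
    ((Matrix.of fun i j : Fin 6 => pderiv j (Z.H i)).transpose *ᵥ (fun l =>
      Sum.elim Z.g Z.f ((finSumFinEquiv (m := 3) (n := 3)).symm (Fin.cast rfl l)))) j =
      pderiv j F := by
  simp only [Matrix.mulVec, dotProduct, Matrix.transpose_apply, Matrix.of_apply, CIDatum.H]
  rw [sum_fin_six_halves (fun s => pderiv j (Sum.elim Z.f Z.g s) * Sum.elim Z.g Z.f s)]
  simp only [Sum.elim_inl, Sum.elim_inr]
  conv_rhs => rw [← Z.sum_eq, map_sum]
  simp only [pderiv_mul]
  rw [Finset.sum_add_distrib]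
  exact congrArg _ (Finset.sum_congr rfl fun i _ => mul_comm _ _)

/-- The swapped forms `c = (g, f)` have the same range as `H = (f, g)`. [folklore] -/
theorem range_swap_eq_range_H (Z : CIDatum F m) :
    Set.range (fun l : Fin 6 =>
      Sum.elim Z.g Z.f ((finSumFinEquiv (m := 3) (n := 3)).symm (Fin.cast rfl l))) =
      Set.range Z.H := by
  have hsurj : Function.Surjective
      (fun l : Fin 6 => (finSumFinEquiv (m := 3) (n := 3)).symm (Fin.cast rfl l)) :=
    fun s => ⟨Fin.cast rfl (finSumFinEquiv (m := 3) (n := 3) s), by simp⟩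
  change Set.range (Sum.elim Z.g Z.f ∘ fun l : Fin 6 =>
      (finSumFinEquiv (m := 3) (n := 3)).symm (Fin.cast rfl l)) =
    Set.range (Sum.elim Z.f Z.g ∘ fun l : Fin 6 =>
      (finSumFinEquiv (m := 3) (n := 3)).symm (Fin.cast rfl l))
  rw [hsurj.range_comp, hsurj.range_comp, Set.Sum.elim_range, Set.Sum.elim_range, Set.union_comm]

/-- The swapped forms lie in the irrelevant ideal (positive degrees). [folklore] -/
theorem swap_mem_originIdeal (Z : CIDatum F m) (l : Fin 6) :
    Sum.elim Z.g Z.f ((finSumFinEquiv (m := 3) (n := 3)).symm (Fin.cast rfl l)) ∈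
      originIdeal k 6 := by
  rw [mem_originIdeal_iff]
  generalize (finSumFinEquiv (m := 3) (n := 3)).symm (Fin.cast rfl l) = s
  cases s with
  | inl i => exact constantCoeff_eq_zero_of_isHomogeneous (Z.g_hom i) (Nat.sub_pos_of_lt (Z.d_lt i))
  | inr i => exact constantCoeff_eq_zero_of_isHomogeneous (Z.f_hom i) (Z.one_le_d i)

/-! ## The stub -/

/-- **Stub S1 `stub_jacobianColon_eq`** (statement `JacobianColonEq` of the line's Defs file):
for a nonsingular form `F` of degree `m ≥ 3` with `m ≠ 0` in `k` and any CI-type datum `Z`,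
`(J^F : P_Z) = ⟨f, g⟩`. [cite: Villaflor2022PeriodsCI, Rem 1] -/
theorem stub_jacobianColon_eq :
    ∀ (k : Type u) [Field k] (m : ℕ) (_ : 3 ≤ m) (_ : (m : k) ≠ 0)
      (F : MvPolynomial (Fin 6) k) (_ : F.IsHomogeneous m)
      (_ : SmoothHypersurface.IsNonsingularForm k F) (Z : CIDatum F m),
      (jacobianIdeal F).colon {Z.transitionDet} = Z.ideal := by
  intro k _ m _ hm F hF hns Z
  -- the swapped forms `c` and the transposed Jacobian matrix `N`
  set c : Fin 6 → MvPolynomial (Fin 6) k := fun l =>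
    Sum.elim Z.g Z.f ((finSumFinEquiv (m := 3) (n := 3)).symm (Fin.cast rfl l)) with hc
  set N : Matrix (Fin 6) (Fin 6) (MvPolynomial (Fin 6) k) :=
    (Matrix.of fun i j : Fin 6 => pderiv j (Z.H i)).transpose with hN
  have hy : N *ᵥ c = fun j => pderiv j F := funext (jacobian_mulVec_swap Z)
  have hJ : jacobianIdeal F = Ideal.span (Set.range (N *ᵥ c)) := by
    rw [hy]
    rfl
  have hdet : N.det = Z.transitionDet := Matrix.det_transpose _
  have hI : Z.ideal = Ideal.span (Set.range c) := by
    rw [CIDatum.ideal, hc, range_swap_eq_range_H]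
  ext r
  rw [Submodule.mem_colon_singleton, smul_eq_mul, mul_comm, ← hdet, hJ, hI]
  refine ⟨fun hr => ?_, fun hr => det_mul_mem_span_of_mem_span N c hr⟩
  -- (⊆): both ideals are `𝔪`-primary, `𝔪 = (x₀, …, x₅)`
  have hc𝔪 : ∀ l, c l ∈ originIdeal k 6 := swap_mem_originIdeal Z
  have hdJ : ∀ j, pderiv j F ∈ Ideal.span (Set.range (N *ᵥ c)) := fun j => by
    rw [← hJ]
    exact Ideal.subset_span ⟨j, rfl⟩
  have hFJ : F ∈ Ideal.span (Set.range (N *ᵥ c)) := by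
    rw [← hJ]
    exact mem_jacobianIdeal_self hF hm
  have hJI : Ideal.span (Set.range (N *ᵥ c)) ≤ Ideal.span (Set.range c) := by
    rw [Ideal.span_le]
    rintro _ ⟨j, rfl⟩
    show (∑ l, N j l * c l) ∈ Ideal.span (Set.range c)
    exact Submodule.sum_mem _ fun l _ => Ideal.mul_mem_left _ _ (Ideal.subset_span ⟨l, rfl⟩)
  obtain ⟨N₀, hN₀⟩ := exists_originIdeal_pow_le hns (hJI hFJ) fun j => hJI (hdJ j)
  obtain ⟨N₁, hN₁⟩ := exists_originIdeal_pow_le hns hFJ hdJ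
  have hL : ∀ i, c i ^ (N₁ + 1) ∈ Ideal.span (Set.range (N *ᵥ c)) := fun i => by
    rw [pow_succ']
    exact Ideal.mul_mem_left _ _ (hN₁ (Ideal.pow_mem_pow (hc𝔪 i) N₁))
  have hdim : (Fintype.card (Fin 6) : WithBot ℕ∞) =
      ringKrullDim (Localization.AtPrime (originIdeal k 6)) := by
    rw [Fintype.card_fin]
    exact (ringKrullDim_originLocalization k 6).symm
  exact mem_span_of_det_mul_mem_span_of_isMaximal _ (originIdeal k 6) _ hdim c hc𝔪 N₀ hN₀ N N₁ hL r
    hr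

end Summit.HodgeConjecture.HodgeConjecture.Theorems.SemiregularSeedsOnAnchors.GorensteinCiSeeds

end
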